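import Literature.Analysis.FluidPDE.TorusLinearisedNSVDataLimits
import Literature.Analysis.FluidPDE.TorusLinearisedNSGevreySmoothing
import HarnessLib

/-!
# Smooth limit slices of `H¹`-Cauchy families of solutions of the linearised Navier–Stokes
# equation along a uniformly Gevrey background on `T^d`

Analysis/FluidPDE proof file (theorems only; no definitions, no named facts): the COMPACTNESS STEP
of the construction of solutions of the linearised Navier–Stokes equation
`∂ₜw + (u·∇)w + (w·∇)u = νΔw − ∇q`, `div w = 0` (Constantin–Foias 1988, Ch. 14, (14.2)–(14.4))
from `V`-data by smooth approximation — the LINEAR twin of `TorusNSVDataExistenceApprox`. Let `u`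
be jointly smooth on `[a, b] × T^d` with divergence-free slices and a uniform Gevrey bound
`∑_{k∈S} e^{2σ₀|k|}‖û(t, k)‖² ≤ C₀`, and let `(w_N, q_N)` be jointly smooth solutions of the
linearised equation along `u` on `[a, b]` with divergence-free mean-zero velocities, initial
`H¹`-level `∫ ‖w_N(a)‖² + ‖∇w_N(a)‖₂² ≤ B` and `H¹`-Cauchy data
`∫ ‖w_N(a) − w_M(a)‖² + ‖∇(w_N − w_M)(a)‖₂² ≤ 2ε_N + 2ε_M`, `ε_N → 0` (for the truncations
`w_N(a) = P_N v₀` of `v₀ ∈ H¹` this is `Torus.h1DistSq_fourierTruncate_le`). Then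
(`Torus.linearisedNS_exists_limit_slices`) there is `w̃ : ℝ → (T^d → ℝ^d)` whose slices on
`(a, b]` are smooth, divergence free and mean zero, with
`∫ ‖w_N(t) − w̃(t)‖² + ‖∇(w_N − w̃)(t)‖₂² ≤ C'ε_N` for all `t ∈ (a, b]` and all `N`.
Proof: by LINEARITY `w_N − w_M` solves the same equation, so the one exponential `H¹` rate of
`Torus.linearisedNS_exists_h1GrowthRate` makes `(w_N(t))` `H¹`-Cauchy uniformly in `t`; at each
`t > a` the slices are uniformly of Gevrey class by the linear Foias–Temam smoothing estimate on
the window `[a, t]` (`Torus.linearisedNS_gevrey_of_gevreyBound`), hence have a smooth `H¹`-limit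
with the rate of the full sequence (`Torus.exists_smooth_h1Limit_of_gevreyBound`).
Deliberately NOT here: that `w̃` solves the equation (`TorusLinearisedNSVDataWindows`).

## Tree search

Reused: `Torus.linearisedNS_gevrey_of_gevreyBound` (`TorusLinearisedNSGevreySmoothing`),
`Torus.linearisedNS_sub_eq` (`TorusLinearisedNSEnergy`), `Torus.linearisedNS_mono`
(`TorusLinearisedNSGrowth`), `Torus.linearisedNS_exists_h1GrowthRate`,
`Torus.exists_smooth_h1Limit_of_gevreyBound` (`TorusLinearisedNSVDataLimits`). Searched
`linearisedNS.*limit_slices`, `linearised.*VData`: nothing.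

## References

* P. Constantin, C. Foias, *Navier–Stokes Equations*, Univ. Chicago Press 1988, Ch. 14,
  (14.2)–(14.4), Lemma 14.3. [ConstantinFoiasNSE1988]
* C. Foias, R. Temam, *Gevrey class regularity for the solutions of the Navier–Stokes equations*,
  JFA 87 (1989), Thm 1.1. [FoiasTemam1989]
* J. C. Robinson, J. L. Rodrigo, W. Sadowski, *The Three-Dimensional Navier–Stokes Equations*,
  CUP 2016, Thm 6.8. [RobinsonRodrigoSadowskiCUP2016]
-/

noncomputable section

open MeasureTheory Set Function Filter UnitAddTorus
open scoped ContDiff InnerProductSpace Topology ENNReal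

namespace Literature.Analysis.FluidPDE

open Literature.Analysis.FunctionSpaces

variable {d : Type*} [Fintype d] [DecidableEq d]

/-- **Smooth limit slices of an `H¹`-Cauchy family of solutions of the linearised Navier–Stokes
equation along a uniformly Gevrey background** (the linear twin of Robinson–Rodrigo–Sadowski 2016,
proof of Thm 6.8: the solutions issued from the truncations `P_N v₀` converge; Constantin–Foias
1988, Ch. 14, Lemma 14.3 for the linearised equation). On `T^d` let `ν > 0`, `σ₀ > 0`, `a < b`,
`u` jointly smooth on `[a, b] × T^d` with divergence-free slices and
`∑_{k∈S} e^{2σ₀|k|}‖𝓕(u t)(k)‖² ≤ C₀` for all `t ∈ [a, b]` and finite `S`; let `(w_N, q_N)` be jointly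
smooth on `[a, b] × T^d` with `div w_N(t) = 0`, `∫ w_N(t) = 0`, solving
`∂ₜw_N + (u·∇)w_N + (w_N·∇)u = νΔw_N − ∇q_N` (one-sided time derivative within `[a, b]`), with
`∫ ‖w_N(a)‖² + ‖∇w_N(a)‖₂² ≤ B` and `∫ ‖w_N(a) − w_M(a)‖² + ‖∇(w_N(a) − w_M(a))‖₂² ≤ 2ε_N + 2ε_M`,
`ε_N → 0`. Then there are `w̃` and `C'` with: for `t ∈ (a, b]` the slice `w̃(t)` is smooth,
divergence free and mean zero, and `∫ ‖w_N(t) − w̃(t)‖² + ‖∇(w_N(t) − w̃(t))‖₂² ≤ C'ε_N` for all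
`N`. [cite: ConstantinFoiasNSE1988, Ch. 14 (14.3) and Lemma 14.3] -/
theorem Torus.linearisedNS_exists_limit_slices {ν : ℝ} (hν : 0 < ν) {σ₀ C₀ : ℝ} (hσ₀ : 0 < σ₀)
    {a b : ℝ} (hab : a < b) {u : ℝ → UnitAddTorus d → EuclideanSpace ℝ d}
    (hu : Torus.IsSmoothSpaceTimeOn (Icc a b) u) (hudiv : ∀ t ∈ Icc a b, Torus.IsDivFree (u t))
    (hGev : ∀ t ∈ Icc a b, ∀ S : Finset (d → ℤ),
      ∑ k ∈ S, Real.exp (2 * σ₀ * Real.sqrt (Torus.freqNormSq k)) *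
        ‖mFourierCoeff (EuclideanSpace.complexify ∘ u t) k‖ ^ 2 ≤ C₀)
    {w : ℕ → ℝ → UnitAddTorus d → EuclideanSpace ℝ d} {q : ℕ → ℝ → UnitAddTorus d → ℝ}
    (hw : ∀ N, Torus.IsSmoothSpaceTimeOn (Icc a b) (w N))
    (hq : ∀ N, Torus.IsSmoothSpaceTimeOn (Icc a b) (q N))
    (hwdiv : ∀ N, ∀ t ∈ Icc a b, Torus.IsDivFree (w N t))
    (hwmean : ∀ N, ∀ t ∈ Icc a b, Torus.HasZeroMean (w N t))
    (hlin : ∀ N, ∀ t ∈ Icc a b, ∀ x, Torus.timeDerivWithin (Icc a b) (w N) t x +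
      Torus.convect (u t) (w N t) x + Torus.convect (w N t) (u t) x =
        ν • Torus.laplacian (w N t) x - Torus.gradient (q N t) x)
    {B : ℝ} (hB : ∀ N, (∫ x, ‖w N a x‖ ^ 2) + Torus.gradNormSq (w N a) ≤ B)
    {ε : ℕ → ℝ} (hε : Tendsto ε atTop (𝓝 0))
    (hpair : ∀ N M, (∫ x, ‖w N a x - w M a x‖ ^ 2) + Torus.gradNormSq (fun x => w N a x - w M a x) ≤
      2 * ε N + 2 * ε M) :
    ∃ (wl : ℝ → UnitAddTorus d → EuclideanSpace ℝ d) (C' : ℝ),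
      (∀ t ∈ Ioc a b, Torus.IsSmooth (wl t) ∧ Torus.IsDivFree (wl t) ∧ Torus.HasZeroMean (wl t)) ∧
      ∀ t ∈ Ioc a b, ∀ N, (∫ x, ‖w N t x - wl t x‖ ^ 2) +
        Torus.gradNormSq (fun x => w N t x - wl t x) ≤ C' * ε N := by
  -- the one exponential `H¹` rate along `u`
  obtain ⟨K, hK0, hK⟩ := Torus.linearisedNS_exists_h1GrowthRate hν hab hu hudiv
  set C : ℝ := 2 * Real.exp (K * (b - a)) with hC_def
  have hws : ∀ N, ∀ t ∈ Icc a b, Torus.IsSmooth (w N t) := fun N t ht => (hw N).isSmooth_slice ht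
  have hB0 : 0 ≤ B :=
    (add_nonneg (integral_nonneg fun x => sq_nonneg _) (Torus.gradNormSq_nonneg _)).trans (hB 0)
  -- Step 1: `(w_N(t))` is `H¹`-Cauchy uniformly in `t`, by linearity
  have hpairt : ∀ N M, ∀ t ∈ Icc a b, (∫ x, ‖w N t x - w M t x‖ ^ 2) +
      Torus.gradNormSq (fun x => w N t x - w M t x) ≤ C * (ε N + ε M) := by
    intro N M t ht
    have hdiv : ∀ s ∈ Icc a b, Torus.IsDivFree (fun y => w N s y - w M s y) := by
      intro s hs x
      rw [show (fun y => w N s y - w M s y) = w N s - w M s from rfl,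
        Torus.divergence_sub (((hw N).isSmooth_slice hs).isContDiff (by simp))
          (((hw M).isSmooth_slice hs).isContDiff (by simp)), hwdiv N s hs x, hwdiv M s hs x, sub_zero]
    have h := hK le_rfl ((hw N).sub (hw M)) ((hq N).sub (hq M)) hdiv
      (fun s hs x => Torus.linearisedNS_sub_eq (hw N) (hq N) (hlin N) (hw M) (hq M) (hlin M) hab hs x) t ht
    have hexp : Real.exp (K * (t - a)) ≤ Real.exp (K * (b - a)) :=
      Real.exp_le_exp.2 (mul_le_mul_of_nonneg_left (by linarith [ht.2]) hK0)
    have hnn : 0 ≤ (∫ x, ‖w N a x - w M a x‖ ^ 2) + Torus.gradNormSq (fun x => w N a x - w M a x) :=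
      add_nonneg (integral_nonneg fun x => sq_nonneg _) (Torus.gradNormSq_nonneg _)
    calc (∫ x, ‖w N t x - w M t x‖ ^ 2) + Torus.gradNormSq (fun x => w N t x - w M t x)
        ≤ ((∫ x, ‖w N a x - w M a x‖ ^ 2) + Torus.gradNormSq (fun x => w N a x - w M a x)) *
            Real.exp (K * (t - a)) := h
      _ ≤ (2 * ε N + 2 * ε M) * Real.exp (K * (b - a)) :=
          mul_le_mul (hpair N M) hexp (Real.exp_pos _).le (hnn.trans (hpair N M))
      _ = C * (ε N + ε M) := by rw [hC_def]; ring
  -- Step 2: at each `t ∈ (a, b]` the slices are uniformly Gevrey, hence have a smooth `H¹`-limit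
  have key : ∀ t ∈ Ioc a b, ∃ wl : UnitAddTorus d → EuclideanSpace ℝ d, Torus.IsSmooth wl ∧
      Torus.IsDivFree wl ∧ Torus.HasZeroMean wl ∧
      ∀ N, (∫ x, ‖w N t x - wl x‖ ^ 2) + Torus.gradNormSq (fun x => w N t x - wl x) ≤ 2 * C * ε N := by
    intro t ht
    have htI : t ∈ Icc a b := ⟨ht.1.le, ht.2⟩
    have hτ : 0 < t - a := sub_pos.2 ht.1
    obtain ⟨σ, hσ, CT, hCT⟩ := Torus.linearisedNS_gevrey_of_gevreyBound (d := d) hν σ₀ C₀ (t - a) hσ₀ hτ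
    have e : a + (t - a) = t := add_sub_cancel a t
    have hlt : a < a + (t - a) := by linarith
    have hsub : Icc a (a + (t - a)) ⊆ Icc a b := by
      rw [e]
      exact Icc_subset_Icc le_rfl ht.2
    have hG : ∀ N, ∀ S : Finset (d → ℤ), ∑ k ∈ S, Real.exp (2 * σ * Real.sqrt (Torus.freqNormSq k)) *
        ‖mFourierCoeff (EuclideanSpace.complexify ∘ w N t) k‖ ^ 2 ≤ max CT 0 * B := by
      intro N S
      have hres := hCT (hu.mono hsub) (fun s hs => hudiv s (hsub hs)) (fun s hs S' => hGev s (hsub hs) S')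
        ((hw N).mono hsub) ((hq N).mono hsub) (fun s hs => hwdiv N s (hsub hs))
        (fun s hs => hwmean N s (hsub hs))
        (fun s hs x => Torus.linearisedNS_mono (hw N) (hlin N) hsub (uniqueDiffOn_Icc hlt) hs x) S
      rw [e] at hres
      have hH0 : 0 ≤ (∫ x, ‖w N a x‖ ^ 2) + Torus.gradNormSq (w N a) :=
        add_nonneg (integral_nonneg fun x => sq_nonneg _) (Torus.gradNormSq_nonneg _)
      calc ∑ k ∈ S, Real.exp (2 * σ * Real.sqrt (Torus.freqNormSq k)) *
            ‖mFourierCoeff (EuclideanSpace.complexify ∘ w N t) k‖ ^ 2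
          ≤ CT * ((∫ x, ‖w N a x‖ ^ 2) + Torus.gradNormSq (w N a)) := hres
        _ ≤ max CT 0 * ((∫ x, ‖w N a x‖ ^ 2) + Torus.gradNormSq (w N a)) :=
            mul_le_mul_of_nonneg_right (le_max_left _ _) hH0
        _ ≤ max CT 0 * B := mul_le_mul_of_nonneg_left (hB N) (le_max_right _ _)
    exact Torus.exists_smooth_h1Limit_of_gevreyBound hσ (fun N => hws N t htI) (fun N => hwdiv N t htI)
      (fun N => hwmean N t htI) hG hε (fun N M => hpairt N M t htI)
  choose! wl hwls hwldiv hwlmean hrate using key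
  exact ⟨wl, 2 * C, fun t ht => ⟨hwls t ht, hwldiv t ht, hwlmean t ht⟩, hrate⟩

end Literature.Analysis.FluidPDE

end
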